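import Summits.QuantumFields.BalabanUV.T4Continuum.Support.NE3CurvedFrameKill
import Summits.QuantumFields.BalabanUV.T4Continuum.Support.MinimalActionLevels
import Summits.QuantumFields.BalabanUV.T4Continuum.Support.AveragingDeficitNearIdentity
import Summits.QuantumFields.BalabanUV.T4Continuum.Support.NE3CurlOfGaugeDir
import Summits.QuantumFields.BalabanUV.T4Continuum.Support.NE3SlicePoincareCompetitorEnergy
import HarnessLib

/-!
# NE7SliceRepFibrePoincare — THE TWO SLICE LETTERS OF A TWO-TERM FIBRE REPRESENTATIVE `X = R + Y`: a frame-free lift `R` of the coarse datum plus a frame-free TANGENT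
# slice element `Y` obeying the η-weighted slice Poincaré inequality give, for `X`, (i) frame-freeness and (ii) the SCALED-MASS POINCARÉ BOUND WITH COARSE-DATA REMAINDER
# `q·dirSq X ≤ 4·C_P·curlSq_W X + (2q·A + 4·C_P·B)` (`A`, `B` = the lift's mass and curl letters) — exactly the displayed hypotheses `hff`, `hP` of
# ✓ `NE7SlicedCoarseCurlLowerBound.coarse_curl_le_hess_of_frameFree_poincare` (lineage `b2b-balaban-t4-ne7-p1`, gen 118, file G1; ROAD-G117 §4 (S1))

Cell `pub-balaban`, rung (B)+1 sub-cell t4, CRUX PROVER NE7 #1 (OWNER of row NE7), generation 118.  Gen 117's F9 closed the (G1)+(G2) half of the sliced curved lower bound for the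
bordered Hessian modulo two properties of the fine representative, displayed there as hypotheses: `hff : framePotW L (j+1) U X̃ = 0` and
`hP : L^{−2(j+1)}·dirSq X̃ ≤ C_P·Σ_p nhsNormSq (curl U X̃ p) + R`.  Row NE3's slice of record `frameFreeBlockLandauW L N (j+1) U` (`NE3FrameFreeSliceW`) consists of TANGENT fields
(`TangentIter`), on which row NE3-R2 proved the class-uniform η-weighted Poincaré inequality `NE3ClassSlicePoincare.classSlicePoincare_of_lines` (shape
`NE3SlicePoincareShape.SlicePoincare`: `((L^k)⁻¹)²·dirSq Y ≤ C·curlSq W Y`).  A fibre element over a non-zero coarse datum `φ` is not tangent; the affine slice through the fibre is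
`R φ + T_♮(W)` for a frame-free right inverse `R` of the linearised `k`-fold average (this lineage's ✓ `NE7FrameFreeRightInverse.rightInvW0`, letters ✓ `NE7FrameFreeRightInverseLetters`).
THIS FILE is the pure algebra of the passage from the slice letters of `Y` and the lift letters of `R` to the two letters of `X = R + Y`:
* §1 `curlSq_periodBox_le_card_mul_sum_nhs` — the currency dictionary `curlSq W X (periodBox P) ≤ card n · Σ_{p∈perWin d P} nhsNormSq (curl W X p)` (B7 (20): `|·|² ≤ N‖·‖²`);
* §2 `dirSq_add_le`, `curlSq_add_le`, `curlSq_sub_le` — two-term splits;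
* §3 **`fibre_poincare`** — `q·dirSq Y ≤ C_P·curlSq W Y`, `dirSq R ≤ A`, `curlSq W R ≤ B` ⟹ `q·dirSq (R+Y) ≤ 4C_P·curlSq W (R+Y) + (2qA + 4C_P·B)`, and **`fibre_poincare_nhs`** (the
  same in F9's `nhsNormSq`∕`perWin` currency, constant `4·C_P·card n`);
* §4 **`framePotW_eq_zero_of_add`** — `framePotW R = 0 ∧ framePotW Y = 0 ⟹ framePotW (R+Y) = 0` (row NE3's `framePotW_add`);
* §5 **`tangentIter_sub_of_dirIter_eq`** — `dirIter (j+1) W X = dirIter (j+1) W R ⟹ TangentIter L j W (X − R)` (row NE3's `dirIter_add`, `tangentIter_iff_dirIter_eq_zero`).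
General `d`, every `U(n)`.
HONEST FRAMING: [folklore] algebra over landed kernel theorems about OUR objects; no estimate of Bałaban's is asserted ([Balaban1985PropagatorsII] Thm 3.3 (3.46) is CONTEXT: an η-weighted
coercivity bound in his gauges); NOT (G′), NOT NE7 as a spine node, NOT NE3; spine 0∕9; finite T⁴ rung (B)+1 — NOT infinite volume, NOT mass gap, NOT BetaPertH, NOT Clay.
-/

set_option autoImplicit false

open scoped BigOperators Matrix.Norms.L2Operator
open Finset

namespace Summit.QuantumFields.BalabanUV.T4Continuum.NE7SliceRepFibrePoincare

open Literature.MathematicalPhysics.QuantumFieldTheory.Balaban1983to89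
open B7Prop1Explicit B7Prop2Explicit MatrixNorms
open T4AveragingDeficitWall (IsUnitaryCfg IsSkewDir SmallField Ad curl curlAt curlSq dirSq)
open T4AveragingDeficitWallBoundary (periodBox)
open T4AveragingDeficitNonAbelian (Ad_sub)
open AveragingDeficitNearIdentity (Ad_add)
open AveragingDeficitMultiLevelPrep (TangentIter LevelSmall)
open MinimalActionLevels (perWin)
open NE3TangentCovariantTower (framePotW dirIter dirIter_add tangentIter_iff_dirIter_eq_zero)
open NE3CurvedFrameKill (framePotW_add)
open NE3CurlOfGaugeDir (norm_sub_sq_le)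
open NE3SlicePoincareCompetitorEnergy (norm_add_sq_le')

noncomputable section

variable {d : ℕ} {n : Type*} [Fintype n] [DecidableEq n]

/-! ## §1 The currency dictionary `curlSq ≤ card n · Σ nhsNormSq` -/

/-- **`curlSq W X (periodBox P) ≤ card n · Σ_{p ∈ perWin d P} nhsNormSq (curl W X p)`** — the operator-norm curl energy of the wall file against the normalised Hilbert–Schmidt curl
energy of the Hessian files (B7 (20), third inequality `|X|² ≤ N‖X‖²`, summed over the period window). [cite: Balaban1985Averaging, (20) p.21] -/
theorem curlSq_periodBox_le_card_mul_sum_nhs (W : Site d → Fin d → (Matrix n n ℂ)ˣ) (X : Site d → Fin d → Matrix n n ℂ) (P : ℕ) :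
    curlSq W X (periodBox (d := d) P) ≤ (Fintype.card n : ℝ) * ∑ p ∈ perWin d P, nhsNormSq (curl W X p) := by
  unfold curlSq
  rw [perWin, Finset.sum_product, Finset.mul_sum]
  refine Finset.sum_le_sum fun z _ => ?_
  rw [Finset.mul_sum]
  exact Finset.sum_le_sum fun π _ => opNorm_sq_le_card_mul_nhsNormSq (curl W X (z, π))

/-! ## §2 Two-term splits -/

/-- **`dirSq (R + Y) F ≤ 2·dirSq R F + 2·dirSq Y F`**. [folklore] -/
theorem dirSq_add_le (R Y : Site d → Fin d → Matrix n n ℂ) (F : Finset (Site d)) :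
    dirSq (fun y ν => R y ν + Y y ν) F ≤ 2 * dirSq R F + 2 * dirSq Y F := by
  unfold dirSq
  rw [Finset.mul_sum, Finset.mul_sum, ← Finset.sum_add_distrib]
  refine Finset.sum_le_sum fun y _ => ?_
  rw [Finset.mul_sum, Finset.mul_sum, ← Finset.sum_add_distrib]
  exact Finset.sum_le_sum fun ν _ => norm_add_sq_le' _ _

/-- The dressed curl is additive in the direction field (pointwise form). [folklore] -/
theorem curlAt_add' (W : Site d → Fin d → (Matrix n n ℂ)ˣ) (R Y : Site d → Fin d → Matrix n n ℂ) (z : Site d) (μ ν : Fin d) :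
    curlAt W (fun y κ => R y κ + Y y κ) z μ ν = curlAt W R z μ ν + curlAt W Y z μ ν := by
  simp only [curlAt, Ad_add]
  abel

/-- The dressed curl respects differences of direction fields (pointwise form). [folklore] -/
theorem curlAt_sub' (W : Site d → Fin d → (Matrix n n ℂ)ˣ) (X R : Site d → Fin d → Matrix n n ℂ) (z : Site d) (μ ν : Fin d) :
    curlAt W (fun y κ => X y κ - R y κ) z μ ν = curlAt W X z μ ν - curlAt W R z μ ν := by
  simp only [curlAt, Ad_sub]
  abel

/-- **`curlSq W (R + Y) F ≤ 2·curlSq W R F + 2·curlSq W Y F`**. [folklore] -/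
theorem curlSq_add_le (W : Site d → Fin d → (Matrix n n ℂ)ˣ) (R Y : Site d → Fin d → Matrix n n ℂ) (F : Finset (Site d)) :
    curlSq W (fun y ν => R y ν + Y y ν) F ≤ 2 * curlSq W R F + 2 * curlSq W Y F := by
  unfold curlSq
  rw [Finset.mul_sum, Finset.mul_sum, ← Finset.sum_add_distrib]
  refine Finset.sum_le_sum fun z _ => ?_
  rw [Finset.mul_sum, Finset.mul_sum, ← Finset.sum_add_distrib]
  refine Finset.sum_le_sum fun π _ => ?_
  show ‖curlAt W (fun y κ => R y κ + Y y κ) z π.1.1 π.1.2‖ ^ 2 ≤ 2 * ‖curlAt W R z π.1.1 π.1.2‖ ^ 2 + 2 * ‖curlAt W Y z π.1.1 π.1.2‖ ^ 2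
  rw [curlAt_add']
  exact norm_add_sq_le' _ _

/-- **`curlSq W (X − R) F ≤ 2·curlSq W X F + 2·curlSq W R F`**. [folklore] -/
theorem curlSq_sub_le (W : Site d → Fin d → (Matrix n n ℂ)ˣ) (X R : Site d → Fin d → Matrix n n ℂ) (F : Finset (Site d)) :
    curlSq W (fun y ν => X y ν - R y ν) F ≤ 2 * curlSq W X F + 2 * curlSq W R F := by
  unfold curlSq
  rw [Finset.mul_sum, Finset.mul_sum, ← Finset.sum_add_distrib]
  refine Finset.sum_le_sum fun z _ => ?_
  rw [Finset.mul_sum, Finset.mul_sum, ← Finset.sum_add_distrib]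
  refine Finset.sum_le_sum fun π _ => ?_
  show ‖curlAt W (fun y κ => X y κ - R y κ) z π.1.1 π.1.2‖ ^ 2 ≤ 2 * ‖curlAt W X z π.1.1 π.1.2‖ ^ 2 + 2 * ‖curlAt W R z π.1.1 π.1.2‖ ^ 2
  rw [curlAt_sub']
  exact norm_sub_sq_le _ _

/-! ## §3 The fibre Poincaré bound with coarse-data remainder -/

/-- **THE SCALED-MASS POINCARÉ BOUND OF A TWO-TERM REPRESENTATIVE** (`curlSq` currency): if `X = R + Y` pointwise, the tangent slice element obeys `q·dirSq Y F ≤ C_P·curlSq W Y F`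
(`0 ≤ q`, `0 ≤ C_P`) and the lift obeys `dirSq R F ≤ A`, `curlSq W R F ≤ B`, then **`q·dirSq X F ≤ 4·C_P·curlSq W X F + (2·q·A + 4·C_P·B)`**. [folklore] -/
theorem fibre_poincare {q CP A B : ℝ} (hq : 0 ≤ q) (hCP : 0 ≤ CP) {W : Site d → Fin d → (Matrix n n ℂ)ˣ}
    {R Y X : Site d → Fin d → Matrix n n ℂ} {F : Finset (Site d)} (hX : ∀ (y : Site d) (ν : Fin d), X y ν = R y ν + Y y ν)
    (hY : q * dirSq Y F ≤ CP * curlSq W Y F) (hRm : dirSq R F ≤ A) (hRc : curlSq W R F ≤ B) :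
    q * dirSq X F ≤ 4 * CP * curlSq W X F + (2 * q * A + 4 * CP * B) := by
  have eX : X = fun y ν => R y ν + Y y ν := funext fun y => funext fun ν => hX y ν
  have eY : Y = fun y ν => X y ν - R y ν := by
    funext y ν; rw [hX y ν]; abel
  have h1 : dirSq X F ≤ 2 * dirSq R F + 2 * dirSq Y F := by rw [eX]; exact dirSq_add_le R Y F
  have h2 : curlSq W Y F ≤ 2 * curlSq W X F + 2 * curlSq W R F := by
    have := curlSq_sub_le W X R F
    rwa [← eY] at this
  have h3 : q * dirSq X F ≤ 2 * q * A + 2 * (q * dirSq Y F) := by nlinarith [mul_le_mul_of_nonneg_left h1 hq, mul_le_mul_of_nonneg_left hRm hq]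
  have h4 : CP * curlSq W Y F ≤ 2 * CP * curlSq W X F + 2 * CP * B := by nlinarith [mul_le_mul_of_nonneg_left h2 hCP, mul_le_mul_of_nonneg_left hRc hCP]
  linarith

/-- **THE SAME IN F9's CURRENCY** (`F = periodBox P`, right side in `nhsNormSq` over `perWin d P`): `q·dirSq X ≤ (4·C_P·card n)·Σ_{p∈perWin d P} nhsNormSq (curl W X p) + (2qA + 4C_P·B)`.
[folklore] -/
theorem fibre_poincare_nhs {q CP A B : ℝ} (hq : 0 ≤ q) (hCP : 0 ≤ CP) {W : Site d → Fin d → (Matrix n n ℂ)ˣ}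
    {R Y X : Site d → Fin d → Matrix n n ℂ} (P : ℕ) (hX : ∀ (y : Site d) (ν : Fin d), X y ν = R y ν + Y y ν)
    (hY : q * dirSq Y (periodBox (d := d) P) ≤ CP * curlSq W Y (periodBox (d := d) P)) (hRm : dirSq R (periodBox (d := d) P) ≤ A)
    (hRc : curlSq W R (periodBox (d := d) P) ≤ B) :
    q * dirSq X (periodBox (d := d) P) ≤ (4 * CP * Fintype.card n) * ∑ p ∈ perWin d P, nhsNormSq (curl W X p) + (2 * q * A + 4 * CP * B) := by
  have h := fibre_poincare hq hCP hX hY hRm hRc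
  have hc := curlSq_periodBox_le_card_mul_sum_nhs W X P
  have h4 : 0 ≤ 4 * CP := by positivity
  calc q * dirSq X (periodBox (d := d) P) ≤ 4 * CP * curlSq W X (periodBox (d := d) P) + (2 * q * A + 4 * CP * B) := h
    _ ≤ 4 * CP * ((Fintype.card n : ℝ) * ∑ p ∈ perWin d P, nhsNormSq (curl W X p)) + (2 * q * A + 4 * CP * B) :=
        add_le_add (mul_le_mul_of_nonneg_left hc h4) le_rfl
    _ = _ := by ring

/-! ## §4 Frame-freeness of the sum -/

/-- **A SUM OF FRAME-FREE FIELDS IS FRAME-FREE** (multi-level small-field class at `W`: unitary, `0 ≤ x`, `LevelSmall d L j x`, `SmallField W x`; `L ≥ 1`): `framePotW L (j+1) W R = 0` and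
`framePotW L (j+1) W Y = 0` give `framePotW L (j+1) W X = 0` for `X = R + Y`. [folklore] -/
theorem framePotW_eq_zero_of_add [Nonempty n] {L : ℕ} (hL : 1 ≤ L) (j : ℕ) {W : Site d → Fin d → (Matrix n n ℂ)ˣ} {x : ℝ}
    (hWu : IsUnitaryCfg W) (hx : 0 ≤ x) (hs : LevelSmall d L j x) (hWx : SmallField W x)
    {R Y X : Site d → Fin d → Matrix n n ℂ} (hX : ∀ (y : Site d) (ν : Fin d), X y ν = R y ν + Y y ν)
    (hR : ∀ z : Site d, framePotW L (j + 1) W R z = 0) (hYf : ∀ z : Site d, framePotW L (j + 1) W Y z = 0) (z : Site d) :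
    framePotW L (j + 1) W X z = 0 := by
  have eX : X = fun y ν => R y ν + Y y ν := funext fun y => funext fun ν => hX y ν
  rw [eX, framePotW_add hL j hWu hx hs hWx R Y z, hR z, hYf z, add_zero]

/-! ## §5 Tangency of the difference of two fields with the same linearised average -/

/-- **TWO FIELDS WITH THE SAME k-FOLD LINEARISED AVERAGE DIFFER BY A TANGENT FIELD** (multi-level small-field class at `W`, `L ≥ 1`):
`dirIter L (j+1) W X = dirIter L (j+1) W R ⟹ TangentIter L j W (X − R)`. [cite: Balaban1985Variational, (83) p.290] -/
theorem tangentIter_sub_of_dirIter_eq [Nonempty n] {L : ℕ} (hL : 1 ≤ L) (j : ℕ) {W : Site d → Fin d → (Matrix n n ℂ)ˣ} {x : ℝ}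
    (hWu : IsUnitaryCfg W) (hx : 0 ≤ x) (hs : LevelSmall d L j x) (hWx : SmallField W x)
    {R X : Site d → Fin d → Matrix n n ℂ} (h : dirIter L (j + 1) W X = dirIter L (j + 1) W R) :
    TangentIter L j W (fun y ν => X y ν - R y ν) := by
  rw [tangentIter_iff_dirIter_eq_zero]
  have eX : X = fun y ν => R y ν + (fun y' ν' => X y' ν' - R y' ν') y ν := by
    funext y ν; simp only [add_sub_cancel]
  have hadd := dirIter_add hL j hWu hx hs hWx R (fun y ν => X y ν - R y ν)
  rw [← eX, h] at hadd
  funext z κ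
  have hz := congrArg (fun f => f z κ) hadd
  simp only at hz
  show dirIter L (j + 1) W (fun y ν => X y ν - R y ν) z κ = (0 : Site d → Fin d → Matrix n n ℂ) z κ
  rw [Pi.zero_apply, Pi.zero_apply]
  exact add_left_cancel (hz.symm.trans (add_zero _).symm)

end

end Summit.QuantumFields.BalabanUV.T4Continuum.NE7SliceRepFibrePoincare
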